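import Mathlib
import HarnessLib
import Summits.Ventures.LatticeQCDFlow.Scoring.UStatisticProjectionsIntegral

/-!
# The strong law for an order-2 U-statistic with a square-integrable symmetric kernel along an
# i.i.d. stream, via Hoeffding's decomposition: the degenerate remainder vanishes almost surely
# by Borel–Cantelli over the WHOLE sequence (its variance is `2ζ/(n(n − 1))`, summable)

HONEST FRAMING: exact (Metropolis-corrected) sampling algorithms for lattice gauge theory;
figures of merit are autocorrelation/cost numbers at stated couplings and volumes; no
continuum-physics claim.

Venture `LatticeQCDFlow` (cell pub-lqcd), topic `Scoring`; FANOUT row 4 (`s0-u1-b`, rung S0-B).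
Row 4's certificates for the printed all-pairs acceptance column
(`Scoring/UStatisticMedianOfBlocks`, `…/AllPairsAcceptanceRatioCeilingFree`,
`…/AllPairsAcceptanceRatioHeavyTail`) are RATE statements;
the `ε = 0` rung — CONSISTENCY of a U-statistic along ONE growing stream — needs a strong law for
U-statistics, which Mathlib does not have.  This file proves it for order 2 under a SECOND moment
of the kernel (the case the acceptance column needs: its kernel `min(w, w′)` is square-integrable
under the model pair law with NO hypothesis on the model — next file), by the textbook route:
Hoeffding's decomposition `U_n(F) − μ_F = 2(H̄_n − μ_F) + U_n(G)` with `h(a) = ∫ F(a, b) dν(b)`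
Hoeffding's projection (`H̄_n` its sample mean — Mathlib's strong law) and
`G(a, b) = F(a, b) − h(a) − h(b) + μ_F` the DEGENERATE remainder (`∫ G(a, b) dν(b) = 0` for EVERY
`a` — also where `F(a, ·) ∉ L¹(ν)`, by Lean's `∫ = 0` convention on both sides); row 3's exact
Hoeffding variance (`Scoring/UStatisticVarianceIntegral.variance_ustat₂_iid`) gives
`Var U_n(G) = 2ζ₂(G)/(n(n − 1))`, which is SUMMABLE in `n`, so the first Borel–Cantelli lemma over
the whole sequence (no subsequence, no monotonicity) gives `U_n(G) → 0` almost surely.  Printed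
counterparts NAMED ONLY (nothing cited as a fact): Hoeffding (Inst. Statist. Mimeo Ser. 302, 1961)
and Berk (Ann. Math. Statist. 37 (1966) 51–58) prove the U-statistic strong law under a FIRST
moment by reverse martingales; Serfling, *Approximation theorems of mathematical statistics* (1980)
§5.2–5.3 is the decomposition used here.  NEW WORK of the cell (our formalisation of folklore);
no definition is introduced; row 3's `Scoring/UStatisticProjectionsIntegral` (Hoeffding's
projection `h ∈ L²(ν)`, `∫ h = μ_F`) and `Scoring/UStatisticVarianceIntegral` are imported.

## Content (`ν` a probability law on `X`; stream `x : ℕ → Ω → X` independent with laws `ν`;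
## `U_n(F) = Σ_{i ≠ j < n} F(x_i, x_j)/(n(n − 1))`; `μ_F = ∫ F d(ν ⊗ ν)`)

* `sum_offDiag_fst`, `sum_offDiag_snd` — `Σ_{z ∈ s.offDiag} f(z.1) = (#s − 1)·Σ_{i ∈ s} f(i)`;
* `ae_eventually_notMem_of_le` — first Borel–Cantelli with real summable bounds;
* **`degenerateUStat_tendsto_zero_ae`** — `G` symmetric, measurable, `G ∈ L²(ν ⊗ ν)`,
  `∫ G(a, b) dν(b) = 0` for all `a` ⇒ `U_n(G) → 0` almost surely;
* the remainder kernel of `F`: `measurable_remainder`, `remainder_symm`, `memLp_remainder_two`,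
  **`integral_remainder_section_eq_zero`** (degenerate for EVERY `a`);
* `ustat₂_eq_remainder_add` — Hoeffding's decomposition as a finite-sum identity (`n ≥ 2`);
* **`ustat₂_tendsto_ae`** — THE STRONG LAW: `F` symmetric, measurable, `F ∈ L²(ν ⊗ ν)` ⇒
  `U_n(F) → ∫ F d(ν ⊗ ν)` almost surely.

NOT CLAIMED: the first-moment (Hoeffding–Berk) version; higher orders; rates (row 4's median-of-
blocks files are the rate statements); any number of ours re-scored.
-/

noncomputable section

namespace Summit.Ventures.LatticeQCDFlow.Scoring.CardConsistency

open MeasureTheory ProbabilityTheory Finset Real Filter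
open scoped Topology Function ENNReal

/-! ## §1 Bookkeeping: one-coordinate sums over the off-diagonal; real Borel–Cantelli -/

section Bookkeeping

variable {ι : Type*} [DecidableEq ι]

/-- `Σ_{z ∈ s.offDiag} f(z.1) = (#s − 1)·Σ_{i ∈ s} f(i)` (each `i` is the first coordinate of
`#s − 1` off-diagonal pairs). [folklore] -/
theorem sum_offDiag_fst (s : Finset ι) (f : ι → ℝ) :
    ∑ z ∈ s.offDiag, f z.1 = ((s.card : ℝ) - 1) * ∑ i ∈ s, f i := by
  have h : ∑ z ∈ s ×ˢ s, f z.1 = ∑ z ∈ s.diag, f z.1 + ∑ z ∈ s.offDiag, f z.1 := by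
    rw [← diag_union_offDiag, sum_union (disjoint_diag_offDiag (s := s))]
  rw [sum_product, sum_diag] at h
  simp only [sum_const, nsmul_eq_mul] at h
  rw [← mul_sum] at h
  linear_combination -h

/-- `Σ_{z ∈ s.offDiag} f(z.2) = (#s − 1)·Σ_{i ∈ s} f(i)`. [folklore] -/
theorem sum_offDiag_snd (s : Finset ι) (f : ι → ℝ) :
    ∑ z ∈ s.offDiag, f z.2 = ((s.card : ℝ) - 1) * ∑ i ∈ s, f i := by
  have h : ∑ z ∈ s ×ˢ s, f z.2 = ∑ z ∈ s.diag, f z.2 + ∑ z ∈ s.offDiag, f z.2 := by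
    rw [← diag_union_offDiag, sum_union (disjoint_diag_offDiag (s := s))]
  rw [sum_product, sum_diag] at h
  simp only [sum_const, nsmul_eq_mul] at h
  linear_combination -h

omit [DecidableEq ι] in
/-- **First Borel–Cantelli lemma with real bounds**: `P(s_k) ≤ a_k`, `a_k ≥ 0` summable ⇒ almost
every point lies outside `s_k` for all large `k`. [folklore] -/
theorem ae_eventually_notMem_of_le {Ω : Type*} [MeasurableSpace Ω] {P : Measure Ω}
    [IsFiniteMeasure P] (s : ℕ → Set Ω) (a : ℕ → ℝ) (ha : ∀ k, 0 ≤ a k) (hsum : Summable a)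
    (hle : ∀ k, P.real (s k) ≤ a k) : ∀ᵐ ω ∂P, ∀ᶠ k in atTop, ω ∉ s k := by
  have h1 : ∀ k, P (s k) ≤ ENNReal.ofReal (a k) := fun k =>
    (ENNReal.le_ofReal_iff_toReal_le (measure_ne_top P _) (ha k)).2 (hle k)
  have h2 : ∑' k, P (s k) ≤ ∑' k, ENNReal.ofReal (a k) := ENNReal.tsum_le_tsum h1
  rw [← ENNReal.ofReal_tsum_of_nonneg ha hsum] at h2
  exact ae_eventually_notMem (ne_top_of_le_ne_top ENNReal.ofReal_ne_top h2)

end Bookkeeping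

/-! ## §2 A degenerate U-statistic vanishes almost surely -/

section Degenerate

variable {Ω : Type*} [MeasurableSpace Ω] {P : Measure Ω} [IsProbabilityMeasure P]
variable {X : Type*} [MeasurableSpace X] {ν : Measure X} {x : ℕ → Ω → X}

omit [IsProbabilityMeasure P] in
/-- The first `n` draws of an independent stream are independent. [folklore] -/
theorem iIndepFun_prefix (hind : iIndepFun x P) (n : ℕ) :
    iIndepFun (fun (i : Fin n) ω => x i ω) P :=
  hind.precomp Fin.val_injective

/-- **A DEGENERATE U-STATISTIC VANISHES ALMOST SURELY.**  For an independent stream `x_i` with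
common law `ν` and a symmetric measurable kernel `G ∈ L²(ν ⊗ ν)` with `∫ G(a, b) dν(b) = 0` for
every `a`: almost surely `U_n(G) = Σ_{i ≠ j < n} G(x_i, x_j)/(n(n − 1)) → 0`.  (Hoeffding:
`E U_n(G) = 0`, `Var U_n(G) = 2∫G²/(n(n − 1))` — summable — then Chebyshev and the first
Borel–Cantelli lemma along the whole sequence.) [ours] -/
theorem degenerateUStat_tendsto_zero_ae (hxm : ∀ i, Measurable (x i)) (hind : iIndepFun x P)
    (hlaw : ∀ i, Measure.map (x i) P = ν) {G : X → X → ℝ}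
    (hGm : Measurable fun z : X × X => G z.1 z.2) (hG : ∀ a b, G a b = G b a)
    (hG2 : MemLp (fun z : X × X => G z.1 z.2) 2 (ν.prod ν)) (hG0 : ∀ a, ∫ b, G a b ∂ν = 0) :
    ∀ᵐ ω ∂P, Tendsto (fun n : ℕ =>
        (∑ z ∈ (univ : Finset (Fin n)).offDiag, G (x z.1 ω) (x z.2 ω)) / (n * (n - 1) : ℝ))
      atTop (𝓝 0) := by
  haveI hν : IsProbabilityMeasure ν := by
    rw [← hlaw 0]
    exact Measure.isProbabilityMeasure_map (hxm 0).aemeasurable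
  -- the population moments of the degenerate kernel: `μ_G = 0`, `c₁(G) = 0`
  have hmean : ∫ z, G z.1 z.2 ∂(ν.prod ν) = 0 := by
    rw [integral_prod _ (hG2.integrable one_le_two)]
    simp only [hG0, integral_zero]
  have hc1 : ∫ a, (∫ b, G a b ∂ν) ^ 2 ∂ν = 0 := by
    simp only [hG0, zero_pow two_ne_zero, integral_zero]
  have hc₂0 : 0 ≤ ∫ z, G z.1 z.2 ^ 2 ∂(ν.prod ν) := integral_nonneg fun _ => sq_nonneg _
  -- Chebyshev for the prefix of length `n ≥ 2`: `P(t ≤ |U_n(G)|) ≤ 2c₂/(n(n − 1)t²)`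
  have hcheb : ∀ n : ℕ, 2 ≤ n → ∀ {t : ℝ}, 0 < t →
      P.real {ω | t ≤ |(∑ z ∈ (univ : Finset (Fin n)).offDiag, G (x z.1 ω) (x z.2 ω))
        / (n * (n - 1) : ℝ)|} ≤ 2 * (∫ z, G z.1 z.2 ^ 2 ∂(ν.prod ν)) / (n * (n - 1)) / t ^ 2 := by
    intro n hn t ht
    have h := chebyshev_ustat₂_iid (P := P) (ν := ν) (x := fun (i : Fin n) ω => x i ω)
      (fun i => hxm _) (iIndepFun_prefix hind n) (fun i => hlaw _) (F := G) hGm hG hG2 hn ht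
    rw [hmean, hc1] at h
    simp only [sub_zero, zero_pow two_ne_zero, mul_zero, add_zero] at h
    have h2 : (2 : ℝ) ≤ n := by exact_mod_cast hn
    have hnn : 0 ≤ 2 * (∫ z, G z.1 z.2 ^ 2 ∂(ν.prod ν)) / (n * (n - 1)) / t ^ 2 := by
      have : (0 : ℝ) < n * (n - 1) := by nlinarith
      positivity
    exact (ENNReal.le_ofReal_iff_toReal_le (measure_ne_top P _) hnn).1 h
  -- Borel–Cantelli along `n = k + 2`, for each `t = 1/(j + 1)`
  have hBC : ∀ j : ℕ, ∀ᵐ ω ∂P, ∀ᶠ n : ℕ in atTop,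
      |(∑ z ∈ (univ : Finset (Fin n)).offDiag, G (x z.1 ω) (x z.2 ω)) / (n * (n - 1) : ℝ)|
        < 1 / ((j : ℝ) + 1) := by
    intro j
    have ht : (0 : ℝ) < 1 / ((j : ℝ) + 1) := by positivity
    -- summable bounds: `2c₂/((k+2)(k+1)t²) ≤ (2c₂/t²)·(1/(k+1)²)`
    have hs1 : Summable fun k : ℕ => 1 / ((k : ℝ) + 1) ^ 2 := by
      have h := (summable_nat_add_iff 1).2 (Real.summable_one_div_nat_pow.2 one_lt_two)
      simpa only [Nat.cast_add, Nat.cast_one] using h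
    have hsum : Summable fun k : ℕ =>
        2 * (∫ z, G z.1 z.2 ^ 2 ∂(ν.prod ν)) / (1 / ((j : ℝ) + 1)) ^ 2 * (1 / ((k : ℝ) + 1) ^ 2) :=
      hs1.mul_left _
    have hle : ∀ k : ℕ, P.real {ω | 1 / ((j : ℝ) + 1) ≤
        |(∑ z ∈ (univ : Finset (Fin (k + 2))).offDiag, G (x z.1 ω) (x z.2 ω))
          / ((k + 2 : ℕ) * ((k + 2 : ℕ) - 1) : ℝ)|}
        ≤ 2 * (∫ z, G z.1 z.2 ^ 2 ∂(ν.prod ν)) / (1 / ((j : ℝ) + 1)) ^ 2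
          * (1 / ((k : ℝ) + 1) ^ 2) := by
      intro k
      refine (hcheb (k + 2) (by omega) ht).trans ?_
      have hk : (0 : ℝ) < (k : ℝ) + 1 := by positivity
      have e : ((k + 2 : ℕ) : ℝ) * (((k + 2 : ℕ) : ℝ) - 1) = ((k : ℝ) + 2) * ((k : ℝ) + 1) := by
        push_cast
        ring
      rw [e]
      have hC : 0 ≤ 2 * (∫ z, G z.1 z.2 ^ 2 ∂(ν.prod ν)) / (1 / ((j : ℝ) + 1)) ^ 2 := by
        positivity
      calc 2 * (∫ z, G z.1 z.2 ^ 2 ∂(ν.prod ν)) / (((k : ℝ) + 2) * ((k : ℝ) + 1))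
            / (1 / ((j : ℝ) + 1)) ^ 2
          = 2 * (∫ z, G z.1 z.2 ^ 2 ∂(ν.prod ν)) / (1 / ((j : ℝ) + 1)) ^ 2
              * (1 / (((k : ℝ) + 2) * ((k : ℝ) + 1))) := by ring
        _ ≤ 2 * (∫ z, G z.1 z.2 ^ 2 ∂(ν.prod ν)) / (1 / ((j : ℝ) + 1)) ^ 2
              * (1 / ((k : ℝ) + 1) ^ 2) :=
            mul_le_mul_of_nonneg_left
              (one_div_le_one_div_of_le (by positivity) (by nlinarith)) hC
    have h := ae_eventually_notMem_of_le (P := P) _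
      (fun k : ℕ => 2 * (∫ z, G z.1 z.2 ^ 2 ∂(ν.prod ν)) / (1 / ((j : ℝ) + 1)) ^ 2
        * (1 / ((k : ℝ) + 1) ^ 2)) (fun k => by positivity) hsum hle
    filter_upwards [h] with ω hω
    rw [← map_add_atTop_eq_nat 2, eventually_map]
    filter_upwards [hω] with k hk
    simpa only [Set.mem_setOf_eq, not_le] using hk
  rw [← ae_all_iff] at hBC
  filter_upwards [hBC] with ω hω
  refine Metric.tendsto_nhds.2 fun ε hε => ?_
  obtain ⟨j, hj⟩ := exists_nat_one_div_lt hε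
  filter_upwards [hω j] with n hn
  rw [Real.dist_eq, sub_zero]
  exact hn.trans hj

end Degenerate

/-! ## §3 Hoeffding's remainder kernel is degenerate -/

section Remainder

variable {X : Type*} [MeasurableSpace X] {ν : Measure X} [IsProbabilityMeasure ν] {F : X → X → ℝ}

omit [IsProbabilityMeasure ν] in
/-- The remainder kernel `G(a, b) = F(a, b) − h(a) − h(b) + μ_F` is measurable. [ours] -/
theorem measurable_remainder [SFinite ν] (hFm : Measurable fun z : X × X => F z.1 z.2) :
    Measurable fun z : X × X =>
      F z.1 z.2 - (∫ b, F z.1 b ∂ν) - (∫ b, F z.2 b ∂ν) + ∫ w, F w.1 w.2 ∂(ν.prod ν) := by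
  have hh : Measurable fun a => ∫ b, F a b ∂ν := (stronglyMeasurable_condMean hFm).measurable
  exact ((hFm.sub (hh.comp measurable_fst)).sub (hh.comp measurable_snd)).add_const _

omit [IsProbabilityMeasure ν] in
/-- The remainder kernel of a symmetric kernel is symmetric. [ours] -/
theorem remainder_symm (hF : ∀ a b, F a b = F b a) (a b : X) :
    F a b - (∫ b', F a b' ∂ν) - (∫ b', F b b' ∂ν) + ∫ w, F w.1 w.2 ∂(ν.prod ν)
      = F b a - (∫ b', F b b' ∂ν) - (∫ b', F a b' ∂ν) + ∫ w, F w.1 w.2 ∂(ν.prod ν) := by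
  rw [hF a b]
  ring

/-- Hoeffding's projection, read on either coordinate of the pair law, is square-integrable.
[ours] -/
theorem memLp_condMean_fst_snd (hFm : Measurable fun z : X × X => F z.1 z.2)
    (hF2 : MemLp (fun z : X × X => F z.1 z.2) 2 (ν.prod ν)) :
    MemLp (fun z : X × X => ∫ b, F z.1 b ∂ν) 2 (ν.prod ν)
      ∧ MemLp (fun z : X × X => ∫ b, F z.2 b ∂ν) 2 (ν.prod ν) := by
  have hh := memLp_condMean_two hFm hF2
  constructor
  · have h : MemLp (fun a => ∫ b, F a b ∂ν) 2 (Measure.map Prod.fst (ν.prod ν)) := by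
      rw [Measure.map_fst_prod, measure_univ, one_smul]
      exact hh
    exact h.comp_of_map measurable_fst.aemeasurable
  · have h : MemLp (fun a => ∫ b, F a b ∂ν) 2 (Measure.map Prod.snd (ν.prod ν)) := by
      rw [Measure.map_snd_prod, measure_univ, one_smul]
      exact hh
    exact h.comp_of_map measurable_snd.aemeasurable

/-- The remainder kernel is square-integrable under the pair law. [ours] -/
theorem memLp_remainder_two (hFm : Measurable fun z : X × X => F z.1 z.2)
    (hF2 : MemLp (fun z : X × X => F z.1 z.2) 2 (ν.prod ν)) :
    MemLp (fun z : X × X =>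
      F z.1 z.2 - (∫ b, F z.1 b ∂ν) - (∫ b, F z.2 b ∂ν) + ∫ w, F w.1 w.2 ∂(ν.prod ν))
      2 (ν.prod ν) := by
  obtain ⟨h1, h2⟩ := memLp_condMean_fst_snd hFm hF2
  exact ((hF2.sub h1).sub h2).add (memLp_const _)

/-- **The remainder kernel is DEGENERATE at EVERY point**: `∫ G(a, b) dν(b) = 0` for all `a`.
Where `F(a, ·) ∈ L¹(ν)` this is `h(a) − h(a) − ∫ h + μ_F = 0` (`∫ h dν = μ_F`); where it is not,
`h(a) = 0` and `G(a, ·) ∉ L¹(ν)` so its integral is `0` as well (Lean's convention on both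
sides). [ours] -/
theorem integral_remainder_section_eq_zero (hFm : Measurable fun z : X × X => F z.1 z.2)
    (hF2 : MemLp (fun z : X × X => F z.1 z.2) 2 (ν.prod ν)) (a : X) :
    ∫ b, (F a b - (∫ b', F a b' ∂ν) - (∫ b', F b b' ∂ν) + ∫ w, F w.1 w.2 ∂(ν.prod ν)) ∂ν = 0 := by
  set m : ℝ := ∫ w, F w.1 w.2 ∂(ν.prod ν) with hm
  have hhi : Integrable (fun b => ∫ b', F b b' ∂ν) ν := (memLp_condMean_two hFm hF2).integrable
    one_le_two
  have hhm : ∫ b, (∫ b', F b b' ∂ν) ∂ν = m := integral_condMean_eq hF2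
  by_cases hFa : Integrable (fun b => F a b) ν
  · have e : (fun b => F a b - (∫ b', F a b' ∂ν) - (∫ b', F b b' ∂ν) + m)
        = fun b => (F a b - ∫ b', F b b' ∂ν) + (m - ∫ b', F a b' ∂ν) := by
      funext b
      ring
    have h1 : Integrable (fun b => F a b - ∫ b', F b b' ∂ν) ν := hFa.sub hhi
    rw [e, integral_add h1 (integrable_const _), integral_sub hFa hhi, hhm,
      integral_const, smul_eq_mul, probReal_univ, one_mul]
    ring
  · refine integral_undef fun hint => hFa ?_
    have e : (fun b => F a b) = fun b => (F a b - (∫ b', F a b' ∂ν) - (∫ b', F b b' ∂ν) + m)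
        + ((∫ b', F b b' ∂ν) + ((∫ b', F a b' ∂ν) - m)) := by
      funext b
      ring
    rw [e]
    exact hint.add (hhi.add (integrable_const _))

end Remainder

/-! ## §4 Hoeffding's decomposition and the strong law -/

section StrongLaw

variable {Ω : Type*} [MeasurableSpace Ω] {P : Measure Ω} [IsProbabilityMeasure P]
variable {X : Type*} [MeasurableSpace X] {ν : Measure X} {x : ℕ → Ω → X}

omit [IsProbabilityMeasure P] in
/-- **Hoeffding's decomposition as a finite-sum identity** (`n ≥ 2`, any reals `h_i`, `m`):
`Σ_{i≠j} F_{ij}/(n(n−1)) = Σ_{i≠j} (F_{ij} − h_i − h_j + m)/(n(n−1)) + 2·(Σ_i h_i)/n − m`. [ours] -/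
theorem ustat₂_eq_remainder_add {n : ℕ} (hn : 2 ≤ n) (Fv : Fin n → Fin n → ℝ) (hv : Fin n → ℝ)
    (m : ℝ) :
    (∑ z ∈ (univ : Finset (Fin n)).offDiag, Fv z.1 z.2) / (n * (n - 1) : ℝ)
      = (∑ z ∈ (univ : Finset (Fin n)).offDiag, (Fv z.1 z.2 - hv z.1 - hv z.2 + m))
            / (n * (n - 1) : ℝ)
          + 2 * ((∑ i : Fin n, hv i) / n) - m := by
  have h2 : (2 : ℝ) ≤ n := by exact_mod_cast hn
  have hn0 : (n : ℝ) ≠ 0 := by positivity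
  have hn1 : (n : ℝ) - 1 ≠ 0 := by
    intro h
    linarith
  have hcard : ((univ : Finset (Fin n)).card : ℝ) = n := by rw [card_univ, Fintype.card_fin]
  have hO : (((univ : Finset (Fin n)).offDiag.card : ℕ) : ℝ) = n * (n - 1) := by
    rw [offDiag_card, card_univ, Fintype.card_fin, Nat.cast_sub (Nat.le_mul_self n)]
    push_cast
    ring
  have hsplit : ∑ z ∈ (univ : Finset (Fin n)).offDiag, (Fv z.1 z.2 - hv z.1 - hv z.2 + m)
      = ∑ z ∈ (univ : Finset (Fin n)).offDiag, Fv z.1 z.2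
        - ∑ z ∈ (univ : Finset (Fin n)).offDiag, hv z.1
        - ∑ z ∈ (univ : Finset (Fin n)).offDiag, hv z.2
        + ∑ z ∈ (univ : Finset (Fin n)).offDiag, m := by
    rw [sum_add_distrib, sum_sub_distrib, sum_sub_distrib]
  rw [hsplit, sum_offDiag_fst, sum_offDiag_snd, sum_const, nsmul_eq_mul, hO, hcard]
  field_simp
  ring

/-- **THE STRONG LAW FOR AN ORDER-2 U-STATISTIC (square-integrable kernel).**  For an independent
stream `x_i` with common law `ν` and a symmetric measurable kernel `F ∈ L²(ν ⊗ ν)`, almost surely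
`U_n(F) = Σ_{i ≠ j < n} F(x_i, x_j)/(n(n − 1)) → ∫ F d(ν ⊗ ν)`. [ours] (Hoeffding's decomposition:
the projection part by Mathlib's strong law `strong_law_ae_real`, the degenerate remainder by
`degenerateUStat_tendsto_zero_ae`) -/
theorem ustat₂_tendsto_ae (hxm : ∀ i, Measurable (x i)) (hind : iIndepFun x P)
    (hlaw : ∀ i, Measure.map (x i) P = ν) {F : X → X → ℝ}
    (hFm : Measurable fun z : X × X => F z.1 z.2) (hF : ∀ a b, F a b = F b a)
    (hF2 : MemLp (fun z : X × X => F z.1 z.2) 2 (ν.prod ν)) :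
    ∀ᵐ ω ∂P, Tendsto (fun n : ℕ =>
        (∑ z ∈ (univ : Finset (Fin n)).offDiag, F (x z.1 ω) (x z.2 ω)) / (n * (n - 1) : ℝ))
      atTop (𝓝 (∫ z, F z.1 z.2 ∂(ν.prod ν))) := by
  haveI hν : IsProbabilityMeasure ν := by
    rw [← hlaw 0]
    exact Measure.isProbabilityMeasure_map (hxm 0).aemeasurable
  set m : ℝ := ∫ w, F w.1 w.2 ∂(ν.prod ν) with hm
  -- Hoeffding's projection along the stream: the strong law
  have hh2 := memLp_condMean_two hFm hF2
  have hhm : Measurable fun a => ∫ b, F a b ∂ν := (stronglyMeasurable_condMean hFm).measurable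
  have hS : ∀ᵐ ω ∂P, Tendsto (fun n : ℕ => (∑ i ∈ range n, ∫ b, F (x i ω) b ∂ν) / n) atTop
      (𝓝 m) := by
    have hid : ∀ i, IdentDistrib (fun ω => ∫ b, F (x i ω) b ∂ν) (fun ω => ∫ b, F (x 0 ω) b ∂ν)
        P P := fun i =>
      ({ aemeasurable_fst := (hxm i).aemeasurable
         aemeasurable_snd := (hxm 0).aemeasurable
         map_eq := by rw [hlaw, hlaw] } : IdentDistrib (x i) (x 0) P P).comp hhm
    have hint : Integrable (fun ω => ∫ b, F (x 0 ω) b ∂ν) P := by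
      have h : Integrable (fun a => ∫ b, F a b ∂ν) (Measure.map (x 0) P) := by
        rw [hlaw]
        exact hh2.integrable one_le_two
      exact h.comp_measurable (hxm 0)
    have h := strong_law_ae_real (μ := P) (fun i ω => ∫ b, F (x i ω) b ∂ν) hint
      (fun i j hij => (hind.indepFun hij).comp hhm hhm) hid
    have e : ∫ ω, (∫ b, F (x 0 ω) b ∂ν) ∂P = m := by
      have him := integral_map (μ := P) (hxm 0).aemeasurable (f := fun a => ∫ b, F a b ∂ν)
        (by rw [hlaw]; exact hhm.aestronglyMeasurable)
      rw [hlaw, integral_condMean_eq hF2] at him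
      rw [← him, hm]
    rw [e] at h
    exact h
  -- the degenerate remainder along the stream vanishes almost surely
  have hR := degenerateUStat_tendsto_zero_ae hxm hind hlaw
    (G := fun a b => F a b - (∫ b', F a b' ∂ν) - (∫ b', F b b' ∂ν) + m)
    (measurable_remainder hFm) (remainder_symm hF) (memLp_remainder_two hFm hF2)
    (integral_remainder_section_eq_zero hFm hF2)
  filter_upwards [hS, hR] with ω hS hR
  -- Hoeffding's decomposition, eventually in `n`
  have hlim : Tendsto (fun n : ℕ =>
      (∑ z ∈ (univ : Finset (Fin n)).offDiag,
          (F (x z.1 ω) (x z.2 ω) - (∫ b', F (x z.1 ω) b' ∂ν) - (∫ b', F (x z.2 ω) b' ∂ν) + m))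
        / (n * (n - 1) : ℝ)
        + 2 * ((∑ i ∈ range n, ∫ b, F (x i ω) b ∂ν) / n) - m) atTop (𝓝 m) := by
    have h := (hR.add (hS.const_mul 2)).sub_const m
    simpa only [zero_add, show (2 : ℝ) * m - m = m by ring] using h
  refine hlim.congr' ?_
  filter_upwards [eventually_ge_atTop 2] with n hn
  rw [ustat₂_eq_remainder_add hn (fun i j => F (x i ω) (x j ω)) (fun i => ∫ b, F (x i ω) b ∂ν) m,
    ← Fin.sum_univ_eq_sum_range (fun i => ∫ b, F (x i ω) b ∂ν) n]

end StrongLaw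

end Summit.Ventures.LatticeQCDFlow.Scoring.CardConsistency

end
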